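import Summits.QuantumFields.GaugeBoot.Certificates.SparseReducedWindow
import Summits.QuantumFields.GaugeBoot.Certificates.KZL2rpLIMCb11o5Chi3o2LoDA
import Summits.QuantumFields.GaugeBoot.Certificates.KZL2rpLIMCb11o5Chi3o2LoDB
import HarnessLib

/-!
# Kernel replay of the certsdp certificate `kzL2_D4_b11o5_max_rp_hkhd_LIMcap_G2-lin-chi22-c3o2-lower` — part G: factor-row assembly (two tiers) and objective (gb_lean_emit_cap 0.12.0-cap)

HONEST FRAMING (cell `pub-gaugeboot`): certified bounds on lattice expectations at stated coupling,
gauge group, dimension and torus size; NOT a mass gap, NOT a continuum limit, NOT a string tension;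
NOT Yang–Mills-summit-bearing (barriers `FixedCouplingUltralocality`, `PerturbativeInvisibility`).

Certificate sha256 `e93b2319ad72fe51785e5f7215e62955eea294d3aaef5cd965049e9aa8ac3e05` (problem `kzL2_D4_b11o5_max_rp_hkhd_LIMcap_G2-lin-chi22-c3o2-lower [objective x144]`, sha256 `2fd6498b6b41993e8e848de00eeb6310504e16734988711a6ee7d654e89c7b77`): `GB` = the first-tier factor rows (data parts
`Certificates/KZL2rpLIMCb11o5Chi3o2LoD….lean` concatenated; family `KZL2rpD4LIM`, 75 blocks), `GBcap` = the factor rows of the two SECOND-TIER blocks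
(`hdcap/R1/D0cap{0..1}`, `hdcap/R1/D1cap{0..1}`; gram duals `Z = G Gᵀ/(4^40·625)` for the ×625 integer blocks `KZL2rpD4LIMCap.EB 558 625`), the INTEGER
objective row `cZ`, the certified bound `lowerQ`, and the kernel checks `gb_len` / `gb2_len` (factor rows fit the padded dimension 48).
Windows: `Certificates/KZL2rpLIMCb11o5Chi3o2LoA….lean`; assembly + theorems: `Certificates/KZL2rpLIMCb11o5Chi3o2Lo.lean`. Data/plumbing only; nothing is claimed about lattice gauge theory here.
-/

namespace Summit.QuantumFields.GaugeBoot.Certificates.KZL2rpLIMCb11o5Chi3o2Lo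

noncomputable section

open Summit.QuantumFields.GaugeBoot.Certificates.Sparse

/-- All first-tier factor rows (concatenation of the data parts' block lists). -/
def GB : List (List (List ℤ)) := GBa ++ GBb

/-- Second-tier factor rows (the two capped difference-Hankel blocks; dual divisor 625). -/
def GBcap : List (List (List ℤ)) := [
  -- second-tier block 0: hdcap/R1/D0cap{0..1} ×625 (2×2), dual divisor 625
  ([
    ([71095533348] : List ℤ), ([Int.negSucc 155363296751, 21264276696] : List ℤ)] : List (List ℤ)),
  -- second-tier block 1: hdcap/R1/D1cap{0..1} ×625 (2×2), dual divisor 625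
  ([
    ([1233470386260] : List ℤ), ([Int.negSucc 2690106357155, 31667441784] : List ℤ)] : List (List ℤ))]

/-- Objective as a sparse INTEGER row: (-48)·y_1 + (144)·y_2 + (-108)·y_13. -/
def cZ : List (ℕ × ℤ) := [(1, Int.negSucc 47), (2, 144), (13, Int.negSucc 107)]

/-- The certified lower bound on the objective (exact): `-5262856630344065940713456172235419583136207/527497617154651455488000000000000000000000` (≈ -9.9770244626548). -/
def lowerQ : ℚ := -5262856630344065940713456172235419583136207/527497617154651455488000000000000000000000

set_option maxHeartbeats 0 in
/-- Kernel check: every first-tier factor row has length `≤ 48`. -/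
theorem gb_len : lenCheckAll KZL2rpLIMCb11o5Chi3o2Lo.GB 48 75 = true := by
  decide +kernel

/-- Kernel check: every second-tier factor row has length `≤ 48`. -/
theorem gb2_len : lenCheckAll KZL2rpLIMCb11o5Chi3o2Lo.GBcap 48 2 = true := by
  decide +kernel

end

end Summit.QuantumFields.GaugeBoot.Certificates.KZL2rpLIMCb11o5Chi3o2Lo
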